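import Mathlib.NumberTheory.NumberField.ClassNumber
import Mathlib.NumberTheory.Padics.RingHoms
import Mathlib.RingTheory.Ideal.Pointwise
import Mathlib.Algebra.Module.Submodule.Pointwise
import HarnessLib

/-!
# Lattices stable under an order of a CM ring: the ideal-class / shape pigeonhole

Pure commutative algebra behind the finiteness of isomorphism classes in an `ℓ`-power isogeny
tower of a CM abelian variety (topic `NumberTheory/ComplexMultiplication`; theorems only, no
definition, no named fact).

SETTING.  `K` is a number field with ring of integers `𝓞 = 𝓞 K` (finite class group, Mathlib
`ClassGroup`), `ℓ` a prime, `T` a `ℤ_ℓ`-module carrying a ring action `ι : 𝓞 → End_{ℤ_ℓ}(T)` and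
FREE OF RANK ONE OVER `ℤ_ℓ ⊗ 𝓞` in the concrete sense of the tree's
`IsCMTypeRealisationOver.exists_basis_eq_tateModuleMap_apply` (`ComplexMultiplication/TateModuleOfCMFreeOverOrder`):
there are `t₀ ∈ T`, an integral basis `(b_k)` of `𝓞` and a `ℤ_ℓ`-basis `(B_k)` of `T` with
`B_k = ι(b_k) t₀`.  (For a CM abelian variety `(A₀, ι₀ : 𝓞 → End A₀)` over a number field:
`T = T_ℓ A₀`, `ι = T_ℓ ∘ ι₀`.)

THE THEOREM (`exists_infinite_forall_exists_pow_smul_map_eq`).  Let `N : ℕ` and let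
`X : ℕ → {ℤ_ℓ-submodules of T}` be any sequence of LATTICES (`ℓ^{j_i} T ⊆ X i`) that are STABLE
UNDER THE ORDER `ℤ_ℓ + ℓᴺ(ℤ_ℓ ⊗ 𝓞)` (`ℓᴺ ι(a) (X i) ⊆ X i` for all `a ∈ 𝓞`).  Then there is an
infinite set `S` of indices such that for all `m, n ∈ S` the lattices `X m`, `X n` are related by a
GLOBAL `ℓ`-UNIT of `𝓞`: there are `e, e' ∈ 𝓞` with `e e' = ℓᵈ` and `ℓᶜ · ι(e)(X m) = ℓᵃ · X n`.
This is exactly the hypothesis of the tree's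
`AbelianVariety.nonempty_iso_of_ellPowerTower_of_pow_smul_map_range_eq`
(`Motives/EllPowerTowerIsoOfEndomorphism`), which turns it into `B m ≅ B n` along an `ℓ`-power tower.

THE ARGUMENT (Shimura 1998 §7.4 Props. 15–17 «ideal classes ↔ isomorphism classes of principal
`(A, ι)`», made `ℓ`-adic and relative; Tate 1966 §2 p. 136 «the number of such `B` up to
isomorphism is finite»).  For a lattice `X` put `X̂ = Σ_a ι(a) X` (its `𝓞`-saturation) and
`𝔞_X = {a ∈ 𝓞 | ι(a) t₀ ∈ X̂}`, an ideal containing `ℓ^{j}`; then `X̂ = ⟨ι(a) t₀ : a ∈ 𝔞_X⟩` (the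
`ℓ`-adic coordinates of an element of `T` are integers modulo `ℓ^j T ⊆ X̂`) and
`ℓᴺ X̂ ⊆ X ⊆ X̂`.  (1) CLASS: the ideal classes `[𝔞_{X i}]` take finitely many values; if
`[𝔞] = [𝔞']`, say `x𝔞 = y𝔞'`, and `ℓⁿ ∈ 𝔞`, `ℓ^{n'} ∈ 𝔞'`, then `e = yℓ^{n'}/x` and `e' = xℓⁿ/y`
lie in `𝓞`, `e e' = ℓ^{n+n'}` and `e𝔞' = ℓ^{n'}𝔞` — no unit theorem is needed.  Transporting,
`ι(e_i) X̂_i = ℓ^{a_i} X̂_{i₀}` on an infinite set of `i`.  (2) SHAPE: then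
`ℓᴺ ℓ^{a_i} X̂_{i₀} ⊆ ι(e_i) X_i ⊆ ℓ^{a_i} X̂_{i₀}`, so `ι(e_i) X_i = ℓ^{a_i} Z_i` with
`ℓ^{N+j₀} T ⊆ Z_i ⊆ T`; there are finitely many such `Z` (`T/ℓ^{N+j₀}T` is finite), so `Z_m = Z_n`
on an infinite set, where `ℓ^{a_n} ι(e'_n e_m) X_m = ℓ^{a_m + d_n} X_n`.

## References

* [Shimura1998] G. Shimura, *Abelian Varieties with Complex Multiplication and Modular Functions*
  (1998), §7.4 Propositions 15 and 17 (homomorphisms and isomorphism classes of principal `(A, ι)`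
  through ideals and ideal classes of `𝓞`).
* [Tate1966Endomorphisms] J. Tate, *Endomorphisms of abelian varieties over finite fields*, Invent.
  Math. 2 (1966), §2, p. 136 (lattices `X ⊆ T_ℓ A` stable under the order generated by Frobenius;
  finiteness of the corresponding isomorphism classes).
-/

noncomputable section

open scoped NumberField Pointwise nonZeroDivisors

namespace Literature.NumberTheory.ComplexMultiplication

section CMLattice

variable {K : Type*} [Field K] [NumberField K] {ℓ : ℕ} [Fact ℓ.Prime]
  {T : Type*} [AddCommGroup T] [Module ℤ_[ℓ] T]
  (ι : 𝓞 K →+* Module.End ℤ_[ℓ] T) (t₀ : T)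
  {κ : Type*} [Fintype κ] (b : Module.Basis κ ℤ (𝓞 K)) (B : Module.Basis κ ℤ_[ℓ] T)

/-! ## §1 `ℓ`-adic coordinates: integers modulo `ℓᴹ` -/

omit [NumberField K] [Fintype κ] in
/-- The element `ι(Σ_k n_k b_k) t₀` has coordinates `(n_k)` in the basis `B_k = ι(b_k) t₀`. [folklore] -/
private theorem apply_sum_natCast_mul (hB : ∀ k, B k = ι (b k) t₀) (s : Finset κ) (n : κ → ℕ) :
    ι (∑ k ∈ s, (n k : 𝓞 K) * b k) t₀ = ∑ k ∈ s, ((n k : ℕ) : ℤ_[ℓ]) • B k := by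
  rw [map_sum, LinearMap.sum_apply]
  refine Finset.sum_congr rfl fun k _ => ?_
  rw [map_mul, map_natCast, Module.End.mul_apply, Module.End.natCast_apply, ← hB,
    Nat.cast_smul_eq_nsmul]

omit [NumberField K] in
/-- `ι(ℓⁿ)` acts as multiplication by `ℓⁿ ∈ ℤ_ℓ`. [folklore] -/
private theorem apply_natCast_pow (n : ℕ) (z : T) : ι ((ℓ : 𝓞 K) ^ n) z = (ℓ : ℤ_[ℓ]) ^ n • z := by
  rw [map_pow, map_natCast]
  induction n with
  | zero => rw [pow_zero, pow_zero, one_smul, Module.End.one_apply]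
  | succ n ih =>
    rw [pow_succ', Module.End.mul_apply, ih, Module.End.natCast_apply,
      ← Nat.cast_smul_eq_nsmul ℤ_[ℓ], ← mul_smul, ← pow_succ']

omit [NumberField K] in
/-- Every `t ∈ T` is congruent modulo `ℓᴹ T` to an element with natural-number coordinates `< ℓᴹ`
(`ℤ` is dense in `ℤ_ℓ`: `PadicInt.appr`). [folklore] -/
private theorem exists_natCoords (M : ℕ) (t : T) :
    ∃ n : κ → ℕ, (∀ k, n k < ℓ ^ M) ∧
      ∃ t' : T, t = ∑ k, ((n k : ℕ) : ℤ_[ℓ]) • B k + (ℓ : ℤ_[ℓ]) ^ M • t' := by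
  classical
  refine ⟨fun k => (B.repr t k).appr M, fun k => PadicInt.appr_lt _ _, ?_⟩
  have hd : ∀ k, ∃ d : ℤ_[ℓ], d * (ℓ : ℤ_[ℓ]) ^ M = B.repr t k - ((B.repr t k).appr M : ℕ) :=
    fun k => Ideal.mem_span_singleton'.mp (PadicInt.appr_spec M (B.repr t k))
  choose d hd using hd
  refine ⟨∑ k, d k • B k, ?_⟩
  conv_lhs => rw [← B.sum_repr t]
  rw [Finset.smul_sum, ← Finset.sum_add_distrib]
  refine Finset.sum_congr rfl fun k _ => ?_
  rw [← mul_smul, mul_comm, hd k, ← add_smul, add_sub_cancel]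

omit [NumberField K] in
include B in
/-- **Finitely many lattices between `ℓᴹ T` and `T`** (`T / ℓᴹ T` is finite): the set of
`ℤ_ℓ`-submodules `Z ⊇ ℓᴹ T` is finite. [folklore] -/
private theorem finite_setOf_pow_smul_top_le (M : ℕ) :
    {Z : Submodule ℤ_[ℓ] T | (ℓ : ℤ_[ℓ]) ^ M • (⊤ : Submodule ℤ_[ℓ] T) ≤ Z}.Finite := by
  classical
  -- code a lattice by the set of its elements with natural-number coordinates `< ℓᴹ`
  let box : Set (κ → ℕ) := Set.univ.pi fun _ => Set.Iio (ℓ ^ M)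
  have hbox : box.Finite := Set.Finite.pi fun _ => Set.finite_Iio _
  let code : Submodule ℤ_[ℓ] T → Set (κ → ℕ) := fun Z =>
    {n | n ∈ box ∧ ∑ k, ((n k : ℕ) : ℤ_[ℓ]) • B k ∈ Z}
  refine Set.Finite.of_finite_image (f := code) ((hbox.finite_subsets).subset ?_) ?_
  · rintro _ ⟨Z, -, rfl⟩
    exact fun n hn => hn.1
  · intro Z hZ Z' hZ' hZZ'
    simp only [Set.mem_setOf_eq] at hZ hZ'
    suffices key : ∀ {Z Z' : Submodule ℤ_[ℓ] T}, (ℓ : ℤ_[ℓ]) ^ M • (⊤ : Submodule ℤ_[ℓ] T) ≤ Z →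
        (ℓ : ℤ_[ℓ]) ^ M • (⊤ : Submodule ℤ_[ℓ] T) ≤ Z' → code Z = code Z' → Z ≤ Z' from
      le_antisymm (key hZ hZ' hZZ') (key hZ' hZ hZZ'.symm)
    intro Z Z' hZ hZ' h t ht
    obtain ⟨n, hn, t', htt'⟩ := exists_natCoords B M t
    have hmem : (ℓ : ℤ_[ℓ]) ^ M • t' ∈ Z := hZ (Submodule.smul_mem_pointwise_smul _ _ _ trivial)
    have hmem' : (ℓ : ℤ_[ℓ]) ^ M • t' ∈ Z' := hZ' (Submodule.smul_mem_pointwise_smul _ _ _ trivial)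
    have hsum : ∑ k, ((n k : ℕ) : ℤ_[ℓ]) • B k ∈ Z := by
      have : ∑ k, ((n k : ℕ) : ℤ_[ℓ]) • B k = t - (ℓ : ℤ_[ℓ]) ^ M • t' := by
        rw [htt', add_sub_cancel_right]
      rw [this]
      exact Z.sub_mem ht hmem
    have hn' : n ∈ code Z := ⟨fun k _ => hn k, hsum⟩
    rw [h] at hn'
    rw [htt']
    exact Z'.add_mem hn'.2 hmem'

/-! ## §2 The lattice `⟨ι(a) t₀ : a ∈ 𝔞⟩` of an ideal -/

omit [NumberField K] in
/-- `⟨ι(a) t₀ : a ∈ x𝔞⟩ = ι(x) ⟨ι(a) t₀ : a ∈ 𝔞⟩`. [folklore] -/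
private theorem span_image_span_singleton_mul (x : 𝓞 K) (𝔞 : Ideal (𝓞 K)) :
    Submodule.span ℤ_[ℓ] ((fun a : 𝓞 K => ι a t₀) '' ↑(Ideal.span {x} * 𝔞)) =
      (Submodule.span ℤ_[ℓ] ((fun a : 𝓞 K => ι a t₀) '' (𝔞 : Set (𝓞 K)))).map (ι x) := by
  rw [Submodule.map_span, ← Set.image_comp]
  congr 1
  ext y
  constructor
  · rintro ⟨a, ha, rfl⟩
    obtain ⟨c, hc, rfl⟩ := Ideal.mem_span_singleton_mul.mp ha
    exact ⟨c, hc, by simp [map_mul, Module.End.mul_apply]⟩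
  · rintro ⟨c, hc, rfl⟩
    exact ⟨x * c, Ideal.mem_span_singleton_mul.mpr ⟨c, hc, rfl⟩, by simp [map_mul, Module.End.mul_apply]⟩

omit [NumberField K] in
/-- `⟨ι(a) t₀ : a ∈ ℓⁿ𝔞⟩ = ℓⁿ ⟨ι(a) t₀ : a ∈ 𝔞⟩`. [folklore] -/
private theorem span_image_pow_mul (n : ℕ) (𝔞 : Ideal (𝓞 K)) :
    Submodule.span ℤ_[ℓ] ((fun a : 𝓞 K => ι a t₀) '' ↑(Ideal.span {((ℓ : 𝓞 K) ^ n)} * 𝔞)) =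
      (ℓ : ℤ_[ℓ]) ^ n • Submodule.span ℤ_[ℓ] ((fun a : 𝓞 K => ι a t₀) '' (𝔞 : Set (𝓞 K))) := by
  rw [span_image_span_singleton_mul]
  ext y
  simp only [Submodule.mem_map, Submodule.mem_smul_pointwise_iff_exists]
  constructor
  · rintro ⟨z, hz, rfl⟩
    exact ⟨z, hz, (apply_natCast_pow ι n z).symm⟩
  · rintro ⟨z, hz, rfl⟩
    exact ⟨z, hz, apply_natCast_pow ι n z⟩

/-! ## §3 The class step: equal ideal classes give a global `ℓ`-unit -/

omit [Fact ℓ.Prime] in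
/-- **Equal ideal classes of two ideals containing powers of `ℓ` are witnessed by a global
`ℓ`-unit**: if `[𝔞] = [𝔞']` in `Cl(𝓞)`, `ℓⁿ ∈ 𝔞` and `ℓ^{n'} ∈ 𝔞'`, there are `e, e' ∈ 𝓞` with
`e e' = ℓ^{n+n'}` and `e 𝔞' = ℓ^{n'} 𝔞` (from `x𝔞 = y𝔞'`: `e = yℓ^{n'}/x`, `e' = xℓⁿ/y`).  Shimura
§7.4 Prop. 15: a non-zero `γ ∈ 𝔞⁻¹𝔟` is a `(γ𝔟⁻¹𝔞)`-multiplication `(A₁, ι₁) → (A₂, ι₂)`.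
[cite: Shimura1998, §7.4 Proposition 15] -/
theorem exists_mul_eq_pow_and_span_mul_eq_of_mk0_eq (ℓ : ℕ) {𝔞 𝔞' : Ideal (𝓞 K)}
    (h𝔞 : 𝔞 ∈ (Ideal (𝓞 K))⁰) (h𝔞' : 𝔞' ∈ (Ideal (𝓞 K))⁰)
    (hcl : ClassGroup.mk0 ⟨𝔞, h𝔞⟩ = ClassGroup.mk0 ⟨𝔞', h𝔞'⟩) {n n' : ℕ}
    (hn : ((ℓ : 𝓞 K) ^ n) ∈ 𝔞) (hn' : ((ℓ : 𝓞 K) ^ n') ∈ 𝔞') :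
    ∃ e e' : 𝓞 K, e * e' = (ℓ : 𝓞 K) ^ (n + n') ∧
      Ideal.span {e} * 𝔞' = Ideal.span {((ℓ : 𝓞 K) ^ n')} * 𝔞 := by
  obtain ⟨x, y, hx, hy, hxy⟩ := ClassGroup.mk0_eq_mk0_iff.mp hcl
  change Ideal.span {x} * 𝔞 = Ideal.span {y} * 𝔞' at hxy
  -- `e x = y ℓ^{n'}` and `e' y = x ℓⁿ`
  have h1 : y * (ℓ : 𝓞 K) ^ n' ∈ Ideal.span {x} := by
    have : y * (ℓ : 𝓞 K) ^ n' ∈ Ideal.span {x} * 𝔞 :=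
      hxy ▸ Ideal.mul_mem_mul (Ideal.mem_span_singleton_self y) hn'
    exact Ideal.mul_le_right this
  have h2 : x * (ℓ : 𝓞 K) ^ n ∈ Ideal.span {y} := by
    have : x * (ℓ : 𝓞 K) ^ n ∈ Ideal.span {y} * 𝔞' :=
      hxy.symm ▸ Ideal.mul_mem_mul (Ideal.mem_span_singleton_self x) hn
    exact Ideal.mul_le_right this
  obtain ⟨e, he⟩ := Ideal.mem_span_singleton'.mp h1
  obtain ⟨e', he'⟩ := Ideal.mem_span_singleton'.mp h2
  refine ⟨e, e', ?_, ?_⟩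
  · have hxy0 : x * y ≠ 0 := mul_ne_zero hx hy
    apply mul_left_cancel₀ hxy0
    calc x * y * (e * e') = (e * x) * (e' * y) := by ring
      _ = (y * (ℓ : 𝓞 K) ^ n') * (x * (ℓ : 𝓞 K) ^ n) := by rw [he, he']
      _ = x * y * (ℓ : 𝓞 K) ^ (n + n') := by ring
  · apply (Ideal.span_singleton_mul_right_inj hx).mp
    calc Ideal.span {x} * (Ideal.span {e} * 𝔞')
        = Ideal.span {e * x} * 𝔞' := by
          rw [← mul_assoc, Ideal.span_singleton_mul_span_singleton, mul_comm x e]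
      _ = Ideal.span {(ℓ : 𝓞 K) ^ n'} * (Ideal.span {y} * 𝔞') := by
          rw [he, ← mul_assoc, Ideal.span_singleton_mul_span_singleton, mul_comm y]
      _ = Ideal.span {x} * (Ideal.span {(ℓ : 𝓞 K) ^ n'} * 𝔞) := by
          rw [← hxy, ← mul_assoc, ← mul_assoc, Ideal.span_singleton_mul_span_singleton,
            Ideal.span_singleton_mul_span_singleton, mul_comm x]

/-! ## §4 The ideal-class / shape pigeonhole -/

/-- **The ideal-class / shape pigeonhole for lattices stable under an order of `𝓞`** (Shimura 1998
§7.4 Props. 15–17 made `ℓ`-adic; Tate 1966 §2 p. 136).  Let `T` be free of rank one over `ℤ_ℓ ⊗ 𝓞`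
(`B_k = ι(b_k) t₀` a `ℤ_ℓ`-basis over an integral basis `(b_k)` of `𝓞 = 𝓞 K`), `N : ℕ`, and
`X : ℕ → Submodule ℤ_ℓ T` a sequence of lattices (`ℓ^{j} T ⊆ X i`) with `ℓᴺ ι(a)(X i) ⊆ X i` for all
`a ∈ 𝓞`.  Then on an infinite set `S` of indices any two lattices are related by a global `ℓ`-unit:
for `m, n ∈ S` there are `e, e' ∈ 𝓞` and `a, c, d` with `e e' = ℓᵈ` and
`ℓᶜ · ι(e)(X m) = ℓᵃ · X n`. [cite: Shimura1998, §7.4 Propositions 15 and 17]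
[cite: Tate1966Endomorphisms, §2 p. 136] -/
theorem exists_infinite_forall_exists_pow_smul_map_eq (hB : ∀ k, B k = ι (b k) t₀) (N : ℕ)
    (X : ℕ → Submodule ℤ_[ℓ] T)
    (htop : ∀ i, ∃ j : ℕ, (ℓ : ℤ_[ℓ]) ^ j • (⊤ : Submodule ℤ_[ℓ] T) ≤ X i)
    (hst : ∀ (i : ℕ) (a : 𝓞 K) (x : T), x ∈ X i → (ℓ : ℤ_[ℓ]) ^ N • ι a x ∈ X i) :
    ∃ S : Set ℕ, S.Infinite ∧ ∀ m ∈ S, ∀ n ∈ S, ∃ (e e' : 𝓞 K) (a c d : ℕ),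
      e * e' = (ℓ : 𝓞 K) ^ d ∧
        (ℓ : ℤ_[ℓ]) ^ c • (X m).map (ι e) = (ℓ : ℤ_[ℓ]) ^ a • X n := by
  classical
  haveI : Module.Free ℤ_[ℓ] T := Module.Free.of_basis B
  have hℓ0 : (ℓ : ℤ_[ℓ]) ≠ 0 := by exact_mod_cast (Fact.out : ℓ.Prime).ne_zero
  have hℓ0' : ∀ j : ℕ, ((ℓ : 𝓞 K) ^ j) ≠ 0 := fun j =>
    pow_ne_zero j (by exact_mod_cast (Fact.out : ℓ.Prime).ne_zero)
  -- cancellation of powers of `ℓ` on submodules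
  have hcancel : ∀ (j : ℕ) {U V : Submodule ℤ_[ℓ] T},
      (ℓ : ℤ_[ℓ]) ^ j • U = (ℓ : ℤ_[ℓ]) ^ j • V → U = V := by
    have key : ∀ (j : ℕ) {U V : Submodule ℤ_[ℓ] T},
        (ℓ : ℤ_[ℓ]) ^ j • U = (ℓ : ℤ_[ℓ]) ^ j • V → U ≤ V := by
      intro j U V h u hu
      have hu' : (ℓ : ℤ_[ℓ]) ^ j • u ∈ (ℓ : ℤ_[ℓ]) ^ j • V :=
        h ▸ Submodule.smul_mem_pointwise_smul _ _ _ hu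
      obtain ⟨v, hv, hvu⟩ := (Submodule.mem_smul_pointwise_iff_exists _ _ _).mp hu'
      rwa [← smul_right_injective T (pow_ne_zero j hℓ0) hvu]
    exact fun j U V h => le_antisymm (key j h) (key j h.symm)
  -- notation: the lattice of an ideal, the saturation, the ideal of a lattice
  set L : Ideal (𝓞 K) → Submodule ℤ_[ℓ] T := fun 𝔞 =>
    Submodule.span ℤ_[ℓ] ((fun a : 𝓞 K => ι a t₀) '' (𝔞 : Set (𝓞 K))) with hL
  set F : ℕ → Submodule ℤ_[ℓ] T := fun i => ⨆ a : 𝓞 K, (X i).map (ι a) with hF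
  -- (F1) `X i ≤ F i`
  have hXF : ∀ i, X i ≤ F i := fun i x hx => by
    refine Submodule.mem_iSup_of_mem (1 : 𝓞 K) ?_
    exact ⟨x, hx, by rw [map_one, Module.End.one_apply]⟩
  -- (F2) `F i` is `ι`-stable
  have hFst : ∀ i (c : 𝓞 K), ∀ y ∈ F i, ι c y ∈ F i := by
    intro i c y hy
    refine Submodule.iSup_induction (fun a : 𝓞 K => (X i).map (ι a)) (motive := fun y => ι c y ∈ F i) hy
      ?_ (by rw [map_zero]; exact Submodule.zero_mem _) (fun y z hy hz => by
        rw [map_add]; exact Submodule.add_mem _ hy hz)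
    rintro a _ ⟨x, hx, rfl⟩
    refine Submodule.mem_iSup_of_mem (c * a) ⟨x, hx, ?_⟩
    rw [map_mul, Module.End.mul_apply]
  -- (F3) `ℓᴺ F i ≤ X i`
  have hNF : ∀ i, ∀ y ∈ F i, (ℓ : ℤ_[ℓ]) ^ N • y ∈ X i := by
    intro i y hy
    refine Submodule.iSup_induction (fun a : 𝓞 K => (X i).map (ι a))
      (motive := fun y => (ℓ : ℤ_[ℓ]) ^ N • y ∈ X i) hy ?_ (by rw [smul_zero]; exact Submodule.zero_mem _)
      (fun y z hy hz => by rw [smul_add]; exact Submodule.add_mem _ hy hz)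
    rintro a _ ⟨x, hx, rfl⟩
    exact hst i a x hx
  -- the ideal of a lattice
  have h𝔞 : ∀ i, ∃ 𝔞 : Ideal (𝓞 K), ∀ a, a ∈ 𝔞 ↔ ι a t₀ ∈ F i := fun i =>
    ⟨{ carrier := {a | ι a t₀ ∈ F i}
       add_mem' := fun {a a'} ha ha' => by
         change ι (a + a') t₀ ∈ F i
         rw [map_add, LinearMap.add_apply]; exact Submodule.add_mem _ ha ha'
       zero_mem' := by change ι 0 t₀ ∈ F i; rw [map_zero, LinearMap.zero_apply]; exact zero_mem _
       smul_mem' := fun c a ha => by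
         change ι (c * a) t₀ ∈ F i
         rw [map_mul, Module.End.mul_apply]; exact hFst i c _ ha }, fun a => Iff.rfl⟩
  choose 𝔞 h𝔞 using h𝔞
  choose j hj using htop
  -- `ℓ^{j i} ∈ 𝔞 i`
  have hℓmem : ∀ i, ((ℓ : 𝓞 K) ^ j i) ∈ 𝔞 i := fun i => by
    rw [h𝔞, apply_natCast_pow]
    exact hXF i (hj i (Submodule.smul_mem_pointwise_smul _ _ _ trivial))
  have h𝔞0 : ∀ i, 𝔞 i ∈ (Ideal (𝓞 K))⁰ := fun i =>
    mem_nonZeroDivisors_iff_ne_zero.mpr fun h0 => hℓ0' (j i) (by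
      have := hℓmem i; rw [h0] at this; exact (Submodule.mem_bot _).mp this)
  -- `ℓ^{j} T ≤ L (𝔞 i)` hence `F i = L (𝔞 i)`
  have hpowL : ∀ i (w : T), (ℓ : ℤ_[ℓ]) ^ j i • w ∈ L (𝔞 i) := by
    intro i w
    rw [← B.sum_repr w, Finset.smul_sum]
    refine Submodule.sum_mem _ fun k _ => ?_
    rw [smul_comm]
    refine Submodule.smul_mem _ _ (Submodule.subset_span ⟨(ℓ : 𝓞 K) ^ j i * b k, ?_, ?_⟩)
    · exact Ideal.mul_mem_right _ _ (hℓmem i)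
    · simp only
      rw [map_mul, Module.End.mul_apply, ← hB, apply_natCast_pow]
  have hFL : ∀ i, F i = L (𝔞 i) := by
    intro i
    apply le_antisymm
    · intro y hy
      obtain ⟨n, -, y', hyy'⟩ := exists_natCoords B (j i) y
      have h1 : (ℓ : ℤ_[ℓ]) ^ j i • y' ∈ F i := hXF i (hj i (Submodule.smul_mem_pointwise_smul _ _ _ trivial))
      have h2 : ι (∑ k, (n k : 𝓞 K) * b k) t₀ ∈ F i := by
        rw [apply_sum_natCast_mul ι t₀ b B hB]
        have : ∑ k, ((n k : ℕ) : ℤ_[ℓ]) • B k = y - (ℓ : ℤ_[ℓ]) ^ j i • y' := by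
          rw [hyy', add_sub_cancel_right]
        rw [this]
        exact Submodule.sub_mem _ hy h1
      rw [hyy']
      refine Submodule.add_mem _ ?_ (hpowL i y')
      rw [← apply_sum_natCast_mul ι t₀ b B hB]
      exact Submodule.subset_span ⟨_, (h𝔞 i _).mpr h2, rfl⟩
    · rw [hL]
      refine Submodule.span_le.mpr ?_
      rintro _ ⟨a, ha, rfl⟩
      exact (h𝔞 i a).mp ha
  -- STEP 1: pigeonhole on ideal classes
  haveI : Fintype (ClassGroup (𝓞 K)) := inferInstance
  obtain ⟨cl, hcl⟩ := Finite.exists_infinite_fiber fun i : ℕ => ClassGroup.mk0 ⟨𝔞 i, h𝔞0 i⟩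
  set S₁ : Set ℕ := (fun i : ℕ => ClassGroup.mk0 ⟨𝔞 i, h𝔞0 i⟩) ⁻¹' {cl} with hS₁
  have hS₁inf : S₁.Infinite := Set.infinite_coe_iff.mp hcl
  obtain ⟨i₀, hi₀⟩ := hS₁inf.nonempty
  -- for `i ∈ S₁`: a global `ℓ`-unit `e_i` with `ι(e_i) F_i = ℓ^{j i} F_{i₀}`
  have hrel : ∀ i ∈ S₁, ∃ e e' : 𝓞 K, e * e' = (ℓ : 𝓞 K) ^ (j i₀ + j i) ∧
      (F i).map (ι e) = (ℓ : ℤ_[ℓ]) ^ j i • F i₀ := by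
    intro i hi
    have hcl' : ClassGroup.mk0 ⟨𝔞 i₀, h𝔞0 i₀⟩ = ClassGroup.mk0 ⟨𝔞 i, h𝔞0 i⟩ := by
      rw [show ClassGroup.mk0 ⟨𝔞 i₀, h𝔞0 i₀⟩ = cl from hi₀, show ClassGroup.mk0 ⟨𝔞 i, h𝔞0 i⟩ = cl from hi]
    obtain ⟨e, e', hee', hspan⟩ :=
      exists_mul_eq_pow_and_span_mul_eq_of_mk0_eq ℓ (h𝔞0 i₀) (h𝔞0 i) hcl' (hℓmem i₀) (hℓmem i)
    refine ⟨e, e', hee', ?_⟩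
    rw [hFL i, hFL i₀, hL]
    simp only
    rw [← span_image_span_singleton_mul ι t₀ e (𝔞 i), hspan, span_image_pow_mul ι t₀ (j i) (𝔞 i₀)]
  -- choose the units (arbitrary outside `S₁`)
  have hrel' : ∀ i, ∃ e e' : 𝓞 K, i ∈ S₁ → e * e' = (ℓ : 𝓞 K) ^ (j i₀ + j i) ∧
      (F i).map (ι e) = (ℓ : ℤ_[ℓ]) ^ j i • F i₀ := fun i => by
    by_cases hi : i ∈ S₁
    · obtain ⟨e, e', h⟩ := hrel i hi; exact ⟨e, e', fun _ => h⟩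
    · exact ⟨0, 0, fun h => (hi h).elim⟩
  choose e e' he using hrel'
  -- STEP 2: the shapes `Z i` with `ι(e i) (X i) = ℓ^{j i} Z i`, `ℓ^{N + j i₀} T ≤ Z i`
  set M : ℕ := N + j i₀ with hM
  clear_value M
  have hshape : ∀ i ∈ S₁, ∃ Z : Submodule ℤ_[ℓ] T,
      (ℓ : ℤ_[ℓ]) ^ M • (⊤ : Submodule ℤ_[ℓ] T) ≤ Z ∧ (X i).map (ι (e i)) = (ℓ : ℤ_[ℓ]) ^ j i • Z := by
    intro i hi
    obtain ⟨hee', hFi⟩ := he i hi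
    -- `Y := ι(e i) (X i)` satisfies `ℓᴺ ℓ^{j i} F i₀ ≤ Y ≤ ℓ^{j i} F i₀`
    have hYle : (X i).map (ι (e i)) ≤ (ℓ : ℤ_[ℓ]) ^ j i • F i₀ :=
      hFi ▸ Submodule.map_mono (hXF i)
    have hYge : ∀ w ∈ F i₀, (ℓ : ℤ_[ℓ]) ^ j i • (ℓ : ℤ_[ℓ]) ^ N • w ∈ (X i).map (ι (e i)) := by
      intro w hw
      have h1 : (ℓ : ℤ_[ℓ]) ^ j i • w ∈ (F i).map (ι (e i)) :=
        hFi ▸ Submodule.smul_mem_pointwise_smul _ _ _ hw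
      obtain ⟨y, hy, hyw⟩ := h1
      refine ⟨(ℓ : ℤ_[ℓ]) ^ N • y, hNF i y hy, ?_⟩
      rw [map_smul, hyw, smul_comm]
    let Z : Submodule ℤ_[ℓ] T :=
      ((X i).map (ι (e i))).comap (LinearMap.lsmul ℤ_[ℓ] T ((ℓ : ℤ_[ℓ]) ^ j i))
    have hZmem : ∀ z, z ∈ Z ↔ (ℓ : ℤ_[ℓ]) ^ j i • z ∈ (X i).map (ι (e i)) := fun z => by
      simp only [Z, Submodule.mem_comap, LinearMap.lsmul_apply]
    refine ⟨Z, ?_, ?_⟩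
    · intro w hw
      obtain ⟨w', -, rfl⟩ := (Submodule.mem_smul_pointwise_iff_exists _ _ _).mp hw
      rw [hZmem, hM, pow_add, mul_smul, smul_comm ((ℓ : ℤ_[ℓ]) ^ j i)]
      rw [smul_comm]
      exact hYge _ (hXF i₀ (hj i₀ (Submodule.smul_mem_pointwise_smul _ _ _ trivial)))
    · apply le_antisymm
      · intro y hy
        obtain ⟨w, hw, hwy⟩ := (Submodule.mem_smul_pointwise_iff_exists _ _ _).mp (hYle hy)
        refine (Submodule.mem_smul_pointwise_iff_exists _ _ _).mpr ⟨w, ?_, hwy⟩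
        rw [hZmem, hwy]; exact hy
      · intro y hy
        obtain ⟨z, hz, rfl⟩ := (Submodule.mem_smul_pointwise_iff_exists _ _ _).mp hy
        exact (hZmem z).mp hz
  have hshape' : ∀ i, ∃ Z : Submodule ℤ_[ℓ] T, i ∈ S₁ →
      (ℓ : ℤ_[ℓ]) ^ M • (⊤ : Submodule ℤ_[ℓ] T) ≤ Z ∧ (X i).map (ι (e i)) = (ℓ : ℤ_[ℓ]) ^ j i • Z :=
    fun i => by
      by_cases hi : i ∈ S₁
      · obtain ⟨Z, h⟩ := hshape i hi; exact ⟨Z, fun _ => h⟩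
      · exact ⟨⊤, fun h => (hi h).elim⟩
  choose Z hZ using hshape'
  -- STEP 3: pigeonhole on shapes
  have hfin := finite_setOf_pow_smul_top_le B M
  let shapes : Type _ := {W : Submodule ℤ_[ℓ] T // (ℓ : ℤ_[ℓ]) ^ M • (⊤ : Submodule ℤ_[ℓ] T) ≤ W}
  haveI : Finite shapes := hfin.to_subtype
  haveI : Infinite S₁ := Set.infinite_coe_iff.mpr hS₁inf
  let sh : S₁ → shapes := fun i => ⟨Z i, (hZ i i.2).1⟩
  obtain ⟨W, hW⟩ := Finite.exists_infinite_fiber sh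
  set S : Set ℕ := Subtype.val '' (sh ⁻¹' {W}) with hS
  have hSinf : S.Infinite :=
    (Set.infinite_coe_iff.mp hW).image Subtype.val_injective.injOn
  have hSmem : ∀ m ∈ S, m ∈ S₁ ∧ Z m = W.1 := by
    rintro m ⟨⟨m', hm'⟩, hm, rfl⟩
    exact ⟨hm', congrArg Subtype.val (show sh ⟨m', hm'⟩ = W from hm)⟩
  refine ⟨S, hSinf, fun m hm n hn => ?_⟩
  obtain ⟨hm₁, hZm⟩ := hSmem m hm
  obtain ⟨hn₁, hZn⟩ := hSmem n hn
  obtain ⟨hee'm, -⟩ := he m hm₁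
  obtain ⟨hee'n, -⟩ := he n hn₁
  obtain ⟨-, hXm⟩ := hZ m hm₁
  obtain ⟨-, hXn⟩ := hZ n hn₁
  -- `ℓ^{j n} ι(e' n * e m) X m = ℓ^{j m + (j i₀ + j n)} X n`
  refine ⟨e' n * e m, e n * e' m, j m + (j i₀ + j n), j n, (j i₀ + j n) + (j i₀ + j m), ?_, ?_⟩
  · calc e' n * e m * (e n * e' m) = (e n * e' n) * (e m * e' m) := by ring
      _ = (ℓ : 𝓞 K) ^ ((j i₀ + j n) + (j i₀ + j m)) := by rw [hee'n, hee'm, ← pow_add]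
  · have hmap_mul : (X m).map (ι (e' n * e m)) = ((X m).map (ι (e m))).map (ι (e' n)) := by
      rw [map_mul, ← Submodule.map_comp]; rfl
    have hn' : ((X n).map (ι (e n))).map (ι (e' n)) = (ℓ : ℤ_[ℓ]) ^ (j i₀ + j n) • X n := by
      rw [← Submodule.map_comp]
      change (X n).map (ι (e' n) * ι (e n)) = _
      rw [← map_mul, mul_comm, hee'n]
      ext y
      simp only [Submodule.mem_map, Submodule.mem_smul_pointwise_iff_exists]
      constructor
      · rintro ⟨z, hz, rfl⟩
        exact ⟨z, hz, (apply_natCast_pow ι _ z).symm⟩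
      · rintro ⟨z, hz, rfl⟩
        exact ⟨z, hz, apply_natCast_pow ι _ z⟩
    rw [hmap_mul, hXm, hZm, Submodule.map_pointwise_smul, pow_add, mul_smul, ← hn', hXn, hZn,
      Submodule.map_pointwise_smul, smul_comm]

end CMLattice

end Literature.NumberTheory.ComplexMultiplication

end
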